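import Literature.AlgebraicGeometry.HodgeTheory.FermatShiodaCondition
import HarnessLib

/-!
# Shioda 1979 (Math. Ann. 245): the character criterion and the main theorems, verbatim, and §4's condition `(Qₘ)`

Topic `Literature/AlgebraicGeometry/Shioda1979`. A STATEMENT-LEVEL index of T. Shioda, *The Hodge
Conjecture for Fermat Varieties*, Math. Ann. **245** (1979) 175–184, written from the text itself
(GDZ scan `PPN235181684_0245/LOG_0030`, lit key `paper:url-c069b2b26db7`, read page by page on
2026-08-19; transcription `run/shared/lean/pub/pub-hfermat/lit/Shioda1979-MathAnn245.md`) — the tree's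
Fermat files so far cite this paper through the announcement [Shioda1979PJA] and [daSilva2021HodgeFermat]
only. Everything declared here is a DEFINITION in the printed form or a PROVED arithmetic statement; the
geometric theorems are quoted below with the tree declarations that carry them. No named fact is added.

## The statements as printed (`[p.N]` = journal page)

* [p.176] `Ĝⁿₘ = {α = (a₀, …, a_{n+1}) | aᵢ ∈ ℤ/m, Σ aᵢ = 0}` (1.1); `V(α) = {ξ ∈ Hⁿ_prim(Xⁿₘ) | g^*ξ = α(g)ξ}`
  (1.3); `𝔄ⁿₘ = {α ∈ Ĝⁿₘ | aᵢ ≠ 0 for all i}` (1.4); `|α| = Σᵢ ⟨aᵢ⟩/m`, `⟨aᵢ⟩ ∈ [1, m−1]`.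
  **Theorem I.** (i) `dim V(α) = 0 or 1` for all `α ∈ Ĝⁿₘ`, and `V(α) ≠ 0` iff `α ∈ 𝔄ⁿₘ`. (ii) The
  subspace `H^{p,q}` of `Hⁿ_prim(Xⁿₘ)` (`p+q = n`) is the direct sum of `V(α)`'s such that `|α| = q+1`.
  (iii) Assume `n = 2p`. Then `(H^{p,p} ∩ Hⁿ_prim(Xⁿₘ, ℚ)) ⊗_ℚ ℂ = ⊕_{α ∈ 𝔅ⁿₘ} V(α)` (1.5), where
  `𝔅ⁿₘ = {α ∈ 𝔄ⁿₘ | |t·α| = p+1 for all t ∈ (ℤ/m)ˣ}` (1.6). (iv) [odd `n`, (1.7)–(1.8)]. "For the proof of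
  (i) and (ii), see Katz [6], Sect. 6 and Ogus [8], Sect. 3 (cf. Tate [13], p. 102)."
  IN THE TREE: (1.6) is `HodgeTheory.FermatCharacter.IsHodge` (`hodgeCharacterSet`/`mem_hodgeCharacterSet_iff`
  below give the printed form); (ii)/(iii) are the named fact `HodgeTheory.Ran1980_fermatEigenspace_hodgeType_pp`
  with `FermatCharacter.isHodge_of_fermatProjector_ne_zero_of_hodgeType`; `V(α)` is
  `HodgeTheory.DiagonalCharacterEigenspace`; [p.177] (1.9) "the Hodge Conjecture for Xⁿₘ is equivalent to
  `𝔈ⁿₘ = 𝔅ⁿₘ`?", (1.10) `𝔈⁰ₘ = 𝔅⁰ₘ`, `𝔈²ₘ = 𝔅²ₘ` (Lefschetz–Hodge).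
* [p.178] **Theorem II.** Let `n = r+s` with `r, s ≥ 1`. Then there exists an isomorphism
  `f : [Hʳ_prim(Xʳₘ) ⊗ Hˢ_prim(Xˢₘ)]^{μₘ} ⊕ [H^{r−1}_prim(X^{r−1}ₘ) ⊗ H^{s−1}_prim(X^{s−1}ₘ)] ⥲ Hⁿ_prim(Xⁿₘ)` (2.4),
  a) `Gⁿₘ`-equivariant, b) preserving the Hodge types on the first summand and increasing them by `(1,1)`
  on the second, c) for `n` even preserving algebraic cycles: c1) `[C_prim(Xʳ) ⊗ C_prim(Xˢ)]^{μₘ} ↪ C_prim(Xⁿ)`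
  (`r, s` even), c2) `C_prim(X^{r−1}) ⊗ C_prim(X^{s−1}) ↪ C_prim(Xⁿ)` (`r, s` odd), and
  `f(class Z₁ ⊗ class Z₂) = m · class(Z₁ ∨ Z₂)` (2.7), `Z₁ ∨ Z₂` the join by lines. [p.179] (2.11)
  `β # γ`, (2.12) `β' * γ'`, (2.14) `V(β#γ) = f(V(β) ⊗ V(γ))`, `V(β'*γ') = f(V(β') ⊗ V(γ'))`;
  **Corollary.** `n = r+s` even: (i) `r, s` odd, `(β',γ') ∈ 𝔈^{r−1} × 𝔈^{s−1}` ⇒ `β'*γ' ∈ 𝔈ⁿ`; (ii) `r, s`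
  even, `(β,γ) ∈ (𝔈ʳ × 𝔈ˢ) ∩ 𝔄^{r,s}` ⇒ `β#γ ∈ 𝔈ⁿ`.
  IN THE TREE: the fields `star`, `hash` of `FermatCharacter.IsShiodaClosed`; named facts
  `HodgeTheory.Aoki1987_claim_juxtaposition` (c2/(i)) and the `hash` input of `FermatClaimShiodaSpine`.
* [p.180] `Mₘ` = non-negative integer solutions `(x₁,…,x_{m−1}; y)`, `y > 0`, of (3.1)
  `Σ_ν ⟨tν⟩ x_ν = m y` for all units `t`; `Mₘ(y)` fixed length `y`; `Mₘ(1)` = the `[m/2]` pairs.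
  "*Definition.* An element `ξ` of `Mₘ` is called *decomposable* if `ξ = ξ' + ξ''` for some `ξ', ξ'' ∈ Mₘ`;
  otherwise `ξ` is called *indecomposable*. An element `ξ` of `Mₘ` is called *quasi-decomposable* if there
  exists `η ∈ Mₘ(1)` such that `ξ + η = ξ' + ξ''` for some `ξ', ξ'' ∈ Mₘ` with `ξ', ξ'' ≠ ξ`." (3.2)
  `{α} = (x₁(α),…,x_{m−1}(α); n/2+1)`. `(Pⁿₘ)` Every indecomposable element of `Mₘ(y)` with
  `3 ≤ y ≤ n/2+1`, if any, is quasi-decomposable. `(Pₘ)` Every indecomposable element of `Mₘ(y)` with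
  `y ≥ 3` is quasi-decomposable.
  **Theorem III.** If the condition `(Pⁿₘ)` is satisfied, then the Hodge Conjecture for `Xⁿₘ` is true. If
  the condition `(Pₘ)` is satisfied, then the Hodge Conjecture for `Xⁿₘ` is true for all `n`. Moreover, if
  `Mₘ` is generated by `Mₘ(1)`, then the space `C(Xⁿₘ)_ℚ` of algebraic cohomology classes on `Xⁿₘ` is
  spanned over `ℚ` by the classes of linear subspaces of `ℙⁿ⁺¹` lying on `Xⁿₘ`.
  [p.181] **Lemma** (W. Parry). If `m` is a prime number or `m = 4`, then `Mₘ` is generated by `Mₘ(1)`.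
  **Corollary (Ran).** `m` prime or `4`: HC for `Xⁿₘ` for all `n`, spanned by linear subspaces. Table of
  the indecomposables of `Mₘ ∖ Mₘ(1)` for `m = 4, 6, 8, 9, 10`; "(Pₘ) is satisfied for m ≤ 10. We have
  also verified the condition `(Pⁿₘ)` for a) `12 ≤ m ≤ 20`, all `n`, and b) `m = 21`, `n ≤ 10`."
  [p.182] **Corollary.** The Hodge Conjecture for `Xⁿₘ` is true for `m ≤ 20`, all `n`. ***Question.* Is the
  condition `(Pₘ)` true for all `m`?** **Theorem IV.** Fix `m ≥ 1`. HC for `X^{r₁}ₘ × … × X^{r_k}ₘ` is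
  true provided that it is true for `Xʳₘ` for all even `r ≤ r₁ + … + r_k + 2(k−1)`; in particular for `m`
  prime or `m ≤ 20`. **Corollary.** `A` isogenous to a product of Jacobians of curves dominated by `X¹ₘ`:
  `(Pₘ)` ⇒ HC for `A` in all codimensions.
  IN THE TREE: `Mₘ` is `FermatCharacter.IsHodgeMultiset` (length = `card/2`), the Definition is
  `FermatCharacter.IsDecomposable` / `IsQuasiDecomposable` VERBATIM (the tree took them from da Silva, whose
  Def. 2.4 is Shioda's Math. Ann. definition word for word — this settles the faithfulness note in
  `FermatShiodaCondition` about the PJA variant `‖η‖ ≤ 2`); `(Pⁿₘ)`, `(Pₘ)` in THIS printed form are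
  `ConditionP`, `ConditionPAll` below (the tree's `ShiodaConditionUpTo`/`ShiodaCondition` are the PJA
  refinement with the extra alternative "semi-decomposable", implied by these:
  `shiodaConditionUpTo_of_conditionP`); Theorem III's conclusion for `m` prime or `1 < m ≤ 20` is the named
  fact `HodgeTheory.hodgeClasses_algebraic_fermat`, its spine `IsShiodaClosed.of_shiodaConditionUpTo` and
  `FermatCharacter.claim_of_shiodaConditionUpTo`; Parry's Lemma is `shiodaCondition_of_prime`,
  `shiodaCondition_four`, `forall_of_pairSplitting`.
* [p.183] §4. **Lemma 1.** `𝔅⁴ₘ ∩ (𝔄¹ₘ * 𝔄¹ₘ) ⊂ 𝔈⁴ₘ`. `ξ ∈ Mₘ` is *semi-decomposable* if `{α} = ξ` for some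
  `α ∈ 𝔅⁴ₘ ∩ (𝔄¹ₘ * 𝔄¹ₘ)`; `Mₘ(3)^{sd}` these; `M'ₘ` = the sub-semigroup of `Mₘ` generated by `Mₘ(1)`, `Mₘ(2)`
  and `Mₘ(3)^{sd}`. **Lemma 2.** `{α ∈ 𝔅ⁿₘ | {α} ∈ M'ₘ} ⊂ 𝔈ⁿₘ`. `(Qⁿₘ)` Every element `ξ` of `Mₘ(y)`,
  `3 ≤ y ≤ n/2+1`, is of the form `ξ = ξ₁ − ξ₂` for some `ξ₁, ξ₂ ∈ M'ₘ`. `(Qₘ)` Every element of `Mₘ` is of the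
  form `ξ₁ − ξ₂` for some `ξ₁, ξ₂ ⊂ M'ₘ`. "In other words, the semigroup `Mₘ` is *stably generated* by `Mₘ(1)`,
  `Mₘ(2)` and `Mₘ(3)^{sd}`. We have the obvious implications: `(Pⁿₘ) ⇒ (Pⁿₘ)` of [12] `⇒ (Qⁿₘ)`;
  `(Pₘ) ⇒ (Pₘ)` of [12] `⇒ (Qₘ)`. **Claim.** In the statements of Theorems III and IV, one can replace the
  conditions `(Pⁿₘ)` or `(Pₘ)` by `(Qⁿₘ)` or `(Qₘ)`." **Lemma 3.** Let `β ∈ 𝔅ʳₘ` and `γ ∈ 𝔈ˢₘ`. If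
  `β*γ ∈ 𝔈^{r+s+2}ₘ`, then `β ∈ 𝔈ʳₘ`. [p.184] "we do not know any value of `m` which satisfies `(Qₘ)` but not
  `(Pₘ)`."  HERE: `primeGenerators`, `MPrime` (= `M'ₘ ∪ {0}` as an additive submonoid of multisets),
  `ConditionQ`, `ConditionQAll`, the PROVED implications `conditionQ_of_shiodaConditionUpTo`
  (`(Pⁿₘ)' ⇒ (Qⁿₘ)`) and `conditionQ_of_conditionP`, and the PROVED arithmetic spine of the Claim,
  `forall_of_conditionQ`: every family of multisets closed under the inductive structure
  (`IsShiodaClosed`, the inputs (1.10), Lemma 1, Cor. to Thm II) and under Lemma 3's cancellation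
  (`IsCancellative`) contains every non-empty Hodge multiset of cardinality `≤ n+2` as soon as `(Qⁿₘ)` holds.
  This is the ℤ-lattice ("stable") criterion used computationally by the fleet's census of Fermat degrees,
  in Shioda's own printed form.

What is NOT here: no geometry (Theorems I, II, III, IV themselves are quoted, not re-vendored; their
carriers in the tree are listed above); no decision of `(Pₘ)`/`(Qₘ)` for particular `m` beyond pointers;
(3.3) (the cardinality of `𝔅ⁿₘ`) and Theorem IV's dimension count `d_m` are not formalised.

## References

* [Shioda1979HodgeFermat] T. Shioda, The Hodge Conjecture for Fermat Varieties, Math. Ann. 245 (1979)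
  175–184 (TEXT READ: GDZ scan, all pages; locators above).
* [Shioda1979PJA] T. Shioda, Proc. Japan Acad. 55A (1979) 111–114 (the announcement [12]; `(Pⁿₘ)'` with the
  semi-decomposable alternative).
* [daSilva2021HodgeFermat] G. da Silva Jr., arXiv:2101.04739, Def. 2.4, Thm. 2.5 (the tree's wording).
* [Ran1980] Z. Ran, Compositio Math. 42 (1980) 121–142, Prop. 1.7–1.8, Thm. 4.9.
-/

open Multiset

namespace Literature.AlgebraicGeometry.Shioda1979

open Literature.AlgebraicGeometry.HodgeTheory
open Literature.AlgebraicGeometry.HodgeTheory.FermatCharacter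

variable {m : ℕ}

/-! ### §1, Theorem I (iii): the set `𝔅ⁿₘ` of Hodge characters, (1.6) verbatim -/

/-- **`𝔅ⁿₘ` as printed, (1.6)**: for `n = 2p`, the admissible characters `α = (a₀, …, a_{n+1})`
(`aᵢ ≠ 0`, `Σ aᵢ = 0`, i.e. `α ∈ 𝔄ⁿₘ`) with `|t·α| = p + 1` for every `t ∈ (ℤ/m)ˣ`, where
`m |α| = Σᵢ ⟨aᵢ⟩ = normSum α`. By Theorem I (iii) these index the eigenlines spanning
`(H^{p,p} ∩ Hⁿ_prim(Xⁿₘ, ℚ)) ⊗ ℂ`. [cite: Shioda1979HodgeFermat, §1 Thm. I (iii), (1.5)–(1.6), p. 176] -/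
def hodgeCharacterSet (m p : ℕ) : Set (Fin (2 * p + 2) → ZMod m) :=
  {α | IsAdmissible α ∧ ∀ t : (ZMod m)ˣ, normSum (fun i ↦ (t : ZMod m) * α i) = m * (p + 1)}

/-- (1.6) is the tree's `FermatCharacter.IsHodge` (which spells the condition as `2 Σ⟨t aᵢ⟩ = m (n+2)`).
[cite: Shioda1979HodgeFermat, §1 (1.6), p. 176] -/
theorem mem_hodgeCharacterSet_iff {p : ℕ} (α : Fin (2 * p + 2) → ZMod m) :
    α ∈ hodgeCharacterSet m p ↔ IsHodge α := by
  simp only [hodgeCharacterSet, Set.mem_setOf_eq, IsHodge]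
  refine and_congr_right fun _ ↦ forall_congr' fun t ↦ ⟨fun h ↦ ?_, fun h ↦ ?_⟩
  · rw [h]; ring
  · apply Nat.eq_of_mul_eq_mul_left (by norm_num : 0 < 2)
    rw [h]; ring

/-! ### §3: the conditions `(Pⁿₘ)`, `(Pₘ)` exactly as printed in Math. Ann. 245 -/

/-- **`(Pⁿₘ)` (Math. Ann. form).** "Every indecomposable element of `Mₘ(y)` with `3 ≤ y ≤ n/2 + 1`, if any,
is quasi-decomposable": every Hodge multiset with `6 ≤ #s ≤ n + 2` (length `y = #s/2`) which is not
decomposable is quasi-decomposable. (The announcement [Shioda1979PJA] and the tree's `ShiodaConditionUpTo`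
add the alternative "or semi-decomposable"; see `shiodaConditionUpTo_of_conditionP`.)
[cite: Shioda1979HodgeFermat, §3 condition (Pⁿₘ), p. 180] -/
def ConditionP (m n : ℕ) : Prop :=
  ∀ s : Multiset (ZMod m), IsHodgeMultiset s → 6 ≤ card s → card s ≤ n + 2 →
    ¬ IsDecomposable s → IsQuasiDecomposable s

/-- **`(Pₘ)` (Math. Ann. form).** "Every indecomposable element of `Mₘ(y)` with `y ≥ 3` is
quasi-decomposable." [cite: Shioda1979HodgeFermat, §3 condition (Pₘ), p. 180] -/
def ConditionPAll (m : ℕ) : Prop :=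
  ∀ s : Multiset (ZMod m), IsHodgeMultiset s → 6 ≤ card s → ¬ IsDecomposable s → IsQuasiDecomposable s

/-- `(Pₘ)` is `(Pⁿₘ)` for all `n`. [cite: Shioda1979HodgeFermat, §3, p. 180] -/
theorem conditionPAll_iff_forall : ConditionPAll m ↔ ∀ n, ConditionP m n :=
  ⟨fun h _ s hs h6 _ hd ↦ h s hs h6 hd, fun h s hs h6 hd ↦ h (card s) s hs h6 (by omega) hd⟩

/-- "These conditions are trivially satisfied if `Mₘ` is generated by `Mₘ(1)` and `Mₘ(2)`": if every Hodge
multiset with at least `6` elements is decomposable then `(Pⁿₘ)` holds (vacuously).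
[cite: Shioda1979HodgeFermat, §3, p. 180 (sentence after (Pₘ))] -/
theorem conditionP_of_forall_isDecomposable {n : ℕ}
    (h : ∀ s : Multiset (ZMod m), IsHodgeMultiset s → 6 ≤ card s → IsDecomposable s) :
    ConditionP m n :=
  fun s hs h6 _ hd ↦ (hd (h s hs h6)).elim

/-- **`(Pⁿₘ) ⇒ (Pⁿₘ)` of [12]** ("the obvious implications", p. 183): the Math. Ann. condition implies
the announcement's refinement, i.e. the tree's `ShiodaConditionUpTo`.
[cite: Shioda1979HodgeFermat, §4, p. 183 ("(Pⁿₘ) ⇒ (Pⁿₘ) of [12]")] -/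
theorem shiodaConditionUpTo_of_conditionP {n : ℕ} (h : ConditionP m n) : ShiodaConditionUpTo m n := by
  intro s hs h6 hle
  by_cases hd : IsDecomposable s
  · exact Or.inl hd
  · exact Or.inr (Or.inl (h s hs h6 hle hd))

/-- **`(Pₘ) ⇒ (Pₘ)` of [12]**, i.e. the tree's `ShiodaCondition`.
[cite: Shioda1979HodgeFermat, §4, p. 183 ("(Pₘ) ⇒ (Pₘ) of [12]")] -/
theorem shiodaCondition_of_conditionPAll (h : ConditionPAll m) : ShiodaCondition m := by
  intro s hs h6
  by_cases hd : IsDecomposable s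
  · exact Or.inl hd
  · exact Or.inr (Or.inl (h s hs h6 hd))

/-! ### §4: `M'ₘ` and the stable-generation conditions `(Qⁿₘ)`, `(Qₘ)` -/

/-- The generators of Shioda's sub-semigroup `M'ₘ`: `Mₘ(1)` (the pairs, `#s = 2`), `Mₘ(2)` (the Hodge
characters of the Fermat surface, `#s = 4`) and `Mₘ(3)^{sd}` (the semi-decomposable elements of length `3`:
a juxtaposition of two characters of the Fermat curve which is a Hodge character of `X⁴ₘ`, Lemma 1).
[cite: Shioda1979HodgeFermat, §4, p. 183 (definition of M'ₘ)] -/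
def primeGenerators (m : ℕ) : Set (Multiset (ZMod m)) :=
  {s | IsHodgeMultiset s ∧ (card s = 2 ∨ card s = 4 ∨ (card s = 6 ∧ IsSemiDecomposable s))}

/-- **`M'ₘ`** (with `0` adjoined): the additive submonoid of multisets of residues generated by `Mₘ(1)`,
`Mₘ(2)` and `Mₘ(3)^{sd}` — "the sub-semigroup of `Mₘ` generated by `Mₘ(1)`, `Mₘ(2)` and `Mₘ(3)^{sd}`".
[cite: Shioda1979HodgeFermat, §4, p. 183 (definition of M'ₘ)] -/
def MPrime (m : ℕ) : AddSubmonoid (Multiset (ZMod m)) :=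
  AddSubmonoid.closure (primeGenerators m)

/-- Elements of `M'ₘ` are Hodge multisets (`M'ₘ ⊂ Mₘ ∪ {0}`). [cite: Shioda1979HodgeFermat, §4, p. 183] -/
theorem isHodgeMultiset_of_mem_mPrime {ξ : Multiset (ZMod m)} (h : ξ ∈ MPrime m) : IsHodgeMultiset ξ := by
  induction h using AddSubmonoid.closure_induction with
  | mem x hx => exact hx.1
  | zero => exact IsHodgeMultiset.zero
  | add x y _ _ hx hy => exact hx.add hy

/-- A generator lies in `M'ₘ`. [cite: Shioda1979HodgeFermat, §4, p. 183] -/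
theorem mem_mPrime_of_mem {s : Multiset (ZMod m)} (h : s ∈ primeGenerators m) : s ∈ MPrime m :=
  AddSubmonoid.subset_closure h

/-- The pair `{a, -a}` (`a ≠ 0`), an element of `Mₘ(1)`, lies in `M'ₘ`.
[cite: Shioda1979HodgeFermat, §3 (Mₘ(1)) and §4, pp. 180, 183] -/
theorem pair_mem_mPrime [NeZero m] {a : ZMod m} (ha : a ≠ 0) :
    ({a, -a} : Multiset (ZMod m)) ∈ MPrime m :=
  mem_mPrime_of_mem ⟨IsHodgeMultiset.pair ha, Or.inl (by simp)⟩

/-- **`(Qⁿₘ)`**: "Every element `ξ` of `Mₘ(y)`, `3 ≤ y ≤ n/2+1`, is of the form `ξ = ξ₁ − ξ₂` for some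
`ξ₁, ξ₂ ∈ M'ₘ`" — as multisets: `ξ + ξ₂ = ξ₁`. [cite: Shioda1979HodgeFermat, §4 condition (Qⁿₘ), p. 183] -/
def ConditionQ (m n : ℕ) : Prop :=
  ∀ s : Multiset (ZMod m), IsHodgeMultiset s → 6 ≤ card s → card s ≤ n + 2 →
    ∃ ξ₁ ∈ MPrime m, ∃ ξ₂ ∈ MPrime m, s + ξ₂ = ξ₁

/-- **`(Qₘ)`**: "Every element of `Mₘ` is of the form `ξ₁ − ξ₂` for some `ξ₁, ξ₂ ⊂ M'ₘ`. In other words,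
the semigroup `Mₘ` is *stably generated* by `Mₘ(1)`, `Mₘ(2)` and `Mₘ(3)^{sd}`."
[cite: Shioda1979HodgeFermat, §4 condition (Qₘ), p. 183] -/
def ConditionQAll (m : ℕ) : Prop :=
  ∀ s : Multiset (ZMod m), IsHodgeMultiset s → ∃ ξ₁ ∈ MPrime m, ∃ ξ₂ ∈ MPrime m, s + ξ₂ = ξ₁

/-- A non-empty Hodge multiset with fewer than `6` elements has `2` or `4` elements. [folklore] -/
theorem card_eq_two_or_four [NeZero m] {s : Multiset (ZMod m)} (hs : IsHodgeMultiset s) (hs0 : s ≠ 0)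
    (h6 : ¬ 6 ≤ card s) : card s = 2 ∨ card s = 4 := by
  obtain ⟨k, hk⟩ := hs.even_card
  have h2 := hs.two_le_card hs0
  omega

/-- Elements of `Mₘ` of length `≤ 2` lie in `M'ₘ` itself, so `(Qₘ)` is `(Qⁿₘ)` for all `n`.
[cite: Shioda1979HodgeFermat, §4, p. 183] -/
theorem conditionQAll_iff_forall [NeZero m] : ConditionQAll m ↔ ∀ n, ConditionQ m n := by
  refine ⟨fun h _ s hs _ _ ↦ h s hs, fun h s hs ↦ ?_⟩
  by_cases hs0 : s = 0
  · exact ⟨0, (MPrime m).zero_mem, 0, (MPrime m).zero_mem, by simp [hs0]⟩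
  by_cases h6 : 6 ≤ card s
  · exact h (card s) s hs h6 (by omega)
  · have hgen : s ∈ primeGenerators m := by
      rcases card_eq_two_or_four hs hs0 h6 with h2 | h4
      · exact ⟨hs, Or.inl h2⟩
      · exact ⟨hs, Or.inr (Or.inl h4)⟩
    exact ⟨s, mem_mPrime_of_mem hgen, 0, (MPrime m).zero_mem, by simp⟩

/-- The family "`s` is stably in `M'ₘ`" (`s + ξ₂ = ξ₁` with `ξ₁, ξ₂ ∈ M'ₘ`) is closed under the inductive
structure: it contains the pairs, the Hodge `4`-sets and the semi-decomposable sextuples, and is closed under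
juxtaposition (add the two identities) and under `#` (`(e ::ₘ t) + ((-e) ::ₘ u) = (t + u) + {e, -e}` and
`{e, -e} ∈ Mₘ(1) ⊂ M'ₘ`). [cite: Shioda1979HodgeFermat, §4, p. 183 ("obvious implications")] -/
theorem isShiodaClosed_stablyMPrime [NeZero m] :
    IsShiodaClosed (fun s : Multiset (ZMod m) ↦ ∃ ξ₁ ∈ MPrime m, ∃ ξ₂ ∈ MPrime m, s + ξ₂ = ξ₁) where
  pair a ha := ⟨{a, -a}, pair_mem_mPrime ha, 0, (MPrime m).zero_mem, by simp⟩
  surface s hs h4 := ⟨s, mem_mPrime_of_mem ⟨hs, Or.inr (Or.inl h4)⟩, 0, (MPrime m).zero_mem, by simp⟩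
  semi s hs hsd := by
    refine ⟨s, mem_mPrime_of_mem ⟨hs, Or.inr (Or.inr ⟨?_, hsd⟩)⟩, 0, (MPrime m).zero_mem, by simp⟩
    obtain ⟨t, u, ht, hu, -, -, rfl⟩ := hsd
    simp [ht, hu]
  star t u _ _ _ _ := by
    rintro ⟨ξ₁, h₁, ξ₂, h₂, ht⟩ ⟨ξ₁', h₁', ξ₂', h₂', hu⟩
    refine ⟨ξ₁ + ξ₁', (MPrime m).add_mem h₁ h₁', ξ₂ + ξ₂', (MPrime m).add_mem h₂ h₂', ?_⟩
    rw [← ht, ← hu]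
    abel
  hash e t u het _ _ _ _ := by
    rintro ⟨ξ₁, h₁, ξ₂, h₂, ht⟩ ⟨ξ₁', h₁', ξ₂', h₂', hu⟩
    have he : e ≠ 0 := het.1.1 e (Multiset.mem_cons_self e t)
    refine ⟨ξ₁ + ξ₁', (MPrime m).add_mem h₁ h₁', {e, -e} + (ξ₂ + ξ₂'),
      (MPrime m).add_mem (pair_mem_mPrime he) ((MPrime m).add_mem h₂ h₂'), ?_⟩
    rw [← ht, ← hu]
    simp only [Multiset.insert_eq_cons, ← Multiset.singleton_add]
    abel

/-- **`(Pⁿₘ)` of [12] `⇒ (Qⁿₘ)`** ("the obvious implications", p. 183): under the announcement's condition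
(the tree's `ShiodaConditionUpTo`, with the semi-decomposable alternative) every Hodge multiset with
`6 ≤ #s ≤ n+2` is stably in `M'ₘ`. Proof: Shioda's induction (`IsShiodaClosed.of_shiodaConditionUpTo`)
applied to the family of `isShiodaClosed_stablyMPrime`. [cite: Shioda1979HodgeFermat, §4, p. 183] -/
theorem conditionQ_of_shiodaConditionUpTo [NeZero m] {n : ℕ} (hP : ShiodaConditionUpTo m n) :
    ConditionQ m n :=
  fun s hs h6 hle ↦ isShiodaClosed_stablyMPrime.of_shiodaConditionUpTo hP s
    (fun h0 ↦ by simp [h0] at h6) hs hle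

/-- **`(Pⁿₘ) ⇒ (Qⁿₘ)`** for the Math. Ann. condition. [cite: Shioda1979HodgeFermat, §4, p. 183] -/
theorem conditionQ_of_conditionP [NeZero m] {n : ℕ} (hP : ConditionP m n) : ConditionQ m n :=
  conditionQ_of_shiodaConditionUpTo (shiodaConditionUpTo_of_conditionP hP)

/-- **`(Pₘ)` of [12] `⇒ (Qₘ)`**. [cite: Shioda1979HodgeFermat, §4, p. 183] -/
theorem conditionQAll_of_shiodaCondition [NeZero m] (hP : ShiodaCondition m) : ConditionQAll m :=
  conditionQAll_iff_forall.2 fun n ↦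
    conditionQ_of_shiodaConditionUpTo (shiodaCondition_iff_forall_upTo.1 hP n)

/-- **`(Pₘ) ⇒ (Qₘ)`** for the Math. Ann. condition. [cite: Shioda1979HodgeFermat, §4, p. 183] -/
theorem conditionQAll_of_conditionPAll [NeZero m] (hP : ConditionPAll m) : ConditionQAll m :=
  conditionQAll_of_shiodaCondition (shiodaCondition_of_conditionPAll hP)

/-! ### §4, Lemmas 2–3 and the Claim: the arithmetic spine of "(Qⁿₘ) ⇒ HC(Xⁿₘ)" -/

/-- **Lemma 3's cancellation property** for a family `C` of multisets (intended: `C = 𝔈ₘ`, the cycle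
characters up to permutation): "Let `β ∈ 𝔅ʳₘ` and `γ ∈ 𝔈ˢₘ`. If `β * γ ∈ 𝔈^{r+s+2}ₘ`, then `β ∈ 𝔈ʳₘ`" — for a
non-empty Hodge multiset `s` and a Hodge multiset `t`, `C (s + t)` and `C t` give `C s`. (Shioda: "This
follows from the obvious fact `[Hʳ(Xʳ) ⊗ C(Xˢ)] ∩ C(Xʳ × Xˢ) = C(Xʳ) ⊗ C(Xˢ)`"; not proved in the tree, so
it is a hypothesis here, in the printed shape.) [cite: Shioda1979HodgeFermat, §4 Lemma 3, p. 183] -/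
def IsCancellative (C : Multiset (ZMod m) → Prop) : Prop :=
  ∀ s t : Multiset (ZMod m), IsHodgeMultiset s → s ≠ 0 → IsHodgeMultiset t → C (s + t) → C t → C s

/-- **Lemma 2**, arithmetic part: a family closed under the inductive structure contains every non-zero
element of `M'ₘ` ("By Corollary to Theorem II, (1.10) and the above Lemma 1, we have Lemma 2.
`{α ∈ 𝔅ⁿₘ | {α} ∈ M'ₘ} ⊂ 𝔈ⁿₘ`"). [cite: Shioda1979HodgeFermat, §4 Lemma 2, p. 183] -/
theorem mem_of_mem_mPrime [NeZero m] {C : Multiset (ZMod m) → Prop} (hC : IsShiodaClosed C) :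
    ∀ ξ ∈ MPrime m, ξ ≠ 0 → C ξ := by
  intro ξ hξ
  induction hξ using AddSubmonoid.closure_induction with
  | mem x hx =>
    intro hx0
    rcases hx.2 with h2 | h4 | ⟨-, hsd⟩
    · obtain ⟨a, ha, rfl⟩ := hx.1.eq_pair_of_card_eq_two h2
      exact hC.pair a ha
    · exact hC.surface x hx.1 h4
    · exact hC.semi x hx.1 hsd
  | zero => exact fun h ↦ (h rfl).elim
  | add x y hx hy ihx ihy =>
    intro hxy
    by_cases hx0 : x = 0
    · subst hx0; rw [zero_add] at hxy ⊢; exact ihy hxy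
    by_cases hy0 : y = 0
    · subst hy0; rw [add_zero] at hxy ⊢; exact ihx hx0
    exact hC.star x y hx0 hy0 (isHodgeMultiset_of_mem_mPrime hx) (isHodgeMultiset_of_mem_mPrime hy)
      (ihx hx0) (ihy hy0)

/-- **The Claim of §4, arithmetic spine** ("In the statements of Theorems III and IV, one can replace the
conditions `(Pⁿₘ)` or `(Pₘ)` by `(Qⁿₘ)` or `(Qₘ)`"): if `(Qⁿₘ)` holds, every family `C` of multisets which
is closed under the inductive structure of Fermat varieties (`IsShiodaClosed`: pairs, Lefschetz on `X²ₘ`,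
Lemma 1, Corollary to Theorem II) and satisfies Lemma 3's cancellation contains every non-empty Hodge
multiset with at most `n + 2` elements. With `C = 𝔈ₘ` this is `(Qⁿₘ) ⇒ 𝔅ᵈₘ = 𝔈ᵈₘ` for all even `d ≤ n`,
i.e. the Hodge Conjecture for `Xᵈₘ` granted the character decomposition of Theorem I.
Proof as printed: `{β} + ξ₂ = ξ₁` with `ξᵢ ∈ M'ₘ ⊂ 𝔈` (Lemma 2), then cancel (Lemma 3).
[cite: Shioda1979HodgeFermat, §4 Claim and its proof, p. 183] -/
theorem forall_of_conditionQ [NeZero m] {C : Multiset (ZMod m) → Prop} (hC : IsShiodaClosed C)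
    (hL : IsCancellative C) {n : ℕ} (hQ : ConditionQ m n) :
    ∀ s : Multiset (ZMod m), s ≠ 0 → IsHodgeMultiset s → card s ≤ n + 2 → C s := by
  intro s hs0 hs hle
  by_cases h6 : 6 ≤ card s
  · obtain ⟨ξ₁, h₁, ξ₂, h₂, heq⟩ := hQ s hs h6 hle
    by_cases hξ₂ : ξ₂ = 0
    · subst hξ₂
      rw [add_zero] at heq
      subst heq
      exact mem_of_mem_mPrime hC s h₁ hs0
    · have hξ₁ : ξ₁ ≠ 0 := by
        rintro rfl
        apply hs0
        have h := congrArg Multiset.card heq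
        simp only [Multiset.card_add, Multiset.card_zero] at h
        exact Multiset.card_eq_zero.1 (by omega)
      exact hL s ξ₂ hs hs0 (isHodgeMultiset_of_mem_mPrime h₂)
        (heq ▸ mem_of_mem_mPrime hC ξ₁ h₁ hξ₁) (mem_of_mem_mPrime hC ξ₂ h₂ hξ₂)
  · rcases card_eq_two_or_four hs hs0 h6 with h2 | h4
    · obtain ⟨a, ha, rfl⟩ := hs.eq_pair_of_card_eq_two h2
      exact hC.pair a ha
    · exact hC.surface s hs h4

/-- **The Claim, uniform in the dimension**: under `(Qₘ)` every non-empty Hodge multiset lies in every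
cancellative family closed under the inductive structure ("the Hodge Conjecture for `Xⁿₘ` is true for all
`n`", granted the geometric inputs). [cite: Shioda1979HodgeFermat, §4 Claim, p. 183] -/
theorem forall_of_conditionQAll [NeZero m] {C : Multiset (ZMod m) → Prop} (hC : IsShiodaClosed C)
    (hL : IsCancellative C) (hQ : ConditionQAll m) :
    ∀ s : Multiset (ZMod m), s ≠ 0 → IsHodgeMultiset s → C s :=
  fun s hs0 hs ↦ forall_of_conditionQ hC hL (conditionQAll_iff_forall.1 hQ (card s)) s hs0 hs le_self_add

end Literature.AlgebraicGeometry.Shioda1979
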